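import Summits.RiemannHypothesis.RiemannHypothesis.Theorems.JensenLogBandArcHolomorphic
import Summits.RiemannHypothesis.RiemannHypothesis.Theorems.JensenLogBandTopShellRegime
import HarnessLib

/-!
# Remaining glue of the two top-shell stubs (BAND line): the far two-point frame, the outer
# composition of `stub_shellFar`, and the centre inequality of the near frame

RH ladder column JENSEN, rung J-P(P3) «log band», BAND crux `XiDerivBandRealAllRates` of route
«JensenLogBand», line «band-one-window» (u-arc, top-shell reshape), lead rh-jensen-prover g8 —
drafted by the custodian rh-jensen-theory g12 (THEORY NOTE #3 `FAR-ZONE-CHECK.md` §5/§7, NOTE #4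
`NEAR-ZONE-CHECK.md` §1 step 5) for the lead / a hand to land verbatim
`--supports stmt-RiemannHypothesis-19913 --as helper`. RH-FREE glue (triangle inequality, real
arithmetic, quantifier bookkeeping). WHAT THIS IS NOT: the two-point ESTIMATES of the far zone and the
disc estimate of the near zone are NOT proved here; nothing here bears on zeros of `ζ` or the truth of RH.

* `norm_lt_norm_of_two_point_models`: `‖U₁ − M₁‖ ≤ ε₁‖M₁‖`, `‖U₂ − M₂‖ ≤ ε₂‖M₂‖`,
  `(1+ε₁)‖M₁‖ < (1−ε₂)‖M₂‖` ⇒ `‖U₁‖ < ‖U₂‖` (the far zone compares the two endpoints directly).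
* `shellFar_of_twoPointModels`: `stub_shellFar` of the lead skeleton (rate `7 ≤ c < 8`, far zone
  `2/c − ¼ < a ≤ ½`) from two-point models supplied under the PINS of the top shell at `(a, T)`
  (`T, ℓ_T ≥ 200`, `c(k−1)/2 − 4 ≤ ℓ_T ≤ ck/2`, `½ ≤ h ≤ 7T/20`, `4/c < h ≤ 4/c + 1/log k`),
  eventually in `k` — via `topShell_regime_norm`.
* `centre_ineq_of_le_third`: `ε ≤ ⅓`, `0 < g`, `56 + 4/g < ℓ`, `ℓ/2 − 14 − 1/g ≤ m` ⇒ `ε/((2/ℓ)(1−ε)) < m`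
  — turns `re_logDeriv_arcShiftModel_centre_ge_ell` (`m = Re(M̃′/M̃)(v₀)`, `δ = g`) into the centre
  hypothesis of `norm_lt_norm_of_disc_models` / `shellNear_of_discModels` with `R = 2/ℓ_T`.
-/

noncomputable section

-- single-problem summit: `Summit.RiemannHypothesis.RiemannHypothesis.…` is the tree convention
set_option linter.dupNamespace false

open Complex Real Set Metric

namespace Summit.RiemannHypothesis.RiemannHypothesis.Theorems.JensenPolynomials.LogBandArc

/-! ## The far two-point frame -/

/-- **Two-point comparison through models.** If `‖U₁ − M₁‖ ≤ ε₁‖M₁‖`, `‖U₂ − M₂‖ ≤ ε₂‖M₂‖` and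
`(1 + ε₁)‖M₁‖ < (1 − ε₂)‖M₂‖`, then `‖U₁‖ < ‖U₂‖`. [folklore] -/
theorem norm_lt_norm_of_two_point_models {U₁ U₂ M₁ M₂ : ℂ} {ε₁ ε₂ : ℝ}
    (h₁ : ‖U₁ - M₁‖ ≤ ε₁ * ‖M₁‖) (h₂ : ‖U₂ - M₂‖ ≤ ε₂ * ‖M₂‖)
    (hlt : (1 + ε₁) * ‖M₁‖ < (1 - ε₂) * ‖M₂‖) : ‖U₁‖ < ‖U₂‖ := by
  have e1 : ‖U₁‖ ≤ ‖M₁‖ + ‖U₁ - M₁‖ := by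
    calc ‖U₁‖ = ‖M₁ + (U₁ - M₁)‖ := by ring_nf
      _ ≤ ‖M₁‖ + ‖U₁ - M₁‖ := norm_add_le _ _
  have e2 : ‖M₂‖ - ‖U₂ - M₂‖ ≤ ‖U₂‖ := by
    calc ‖M₂‖ - ‖U₂ - M₂‖ ≤ ‖M₂ - (M₂ - U₂)‖ := by
          rw [show U₂ - M₂ = -(M₂ - U₂) by ring, norm_neg]; exact norm_sub_norm_le _ _
      _ = ‖U₂‖ := by ring_nf
  nlinarith [norm_nonneg M₁, norm_nonneg M₂, norm_nonneg (U₁ - M₁), norm_nonneg (U₂ - M₂)]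

/-! ## The outer composition: `stub_shellFar` from two-point models -/

/-- **`stub_shellFar` from two-point models (RH-FREE glue).** Fix a rate `7 ≤ c < 8`. Suppose
that, eventually in `k`, for every far point (`2/c − ¼ < a ≤ ½`, `0 < T`) carrying the pins of the
top shell there are models `M₁, M₂ ∈ ℂ` of `U_h(−a+iT)`, `U_h(a+iT)` (`h = bandRadius k T`) with
relative errors `ε₁, ε₂` and `(1+ε₁)‖M₁‖ < (1−ε₂)‖M₂‖`. Then the conclusion of `stub_shellFar` holds
at rate `c`. [folklore] -/
theorem shellFar_of_twoPointModels {c : ℝ} (hc7 : 7 ≤ c) (hc8 : c < 8)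
    (hfar : ∃ k₂ : ℕ, ∀ k : ℕ, k₂ ≤ k → ∀ a T : ℝ, 2 / c - 1 / 4 < a → a ≤ 1 / 2 → 200 ≤ T →
      200 ≤ ell T → c * ((k : ℝ) - 1) / 2 - 4 ≤ ell T → ell T ≤ c * (k : ℝ) / 2 →
      1 / 2 ≤ bandRadius k T → bandRadius k T ≤ 7 / 20 * T →
      4 / c < bandRadius k T → bandRadius k T ≤ 4 / c + 1 / Real.log k →
      ∃ (M₁ M₂ : ℂ) (ε₁ ε₂ : ℝ),
        ‖xiSqArcU k (bandRadius k T) (-(a : ℂ) + (T : ℂ) * I) - M₁‖ ≤ ε₁ * ‖M₁‖ ∧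
        ‖xiSqArcU k (bandRadius k T) ((a : ℂ) + (T : ℂ) * I) - M₂‖ ≤ ε₂ * ‖M₂‖ ∧
        (1 + ε₁) * ‖M₁‖ < (1 - ε₂) * ‖M₂‖) :
    ∃ k₂ : ℕ, ∀ k : ℕ, k₂ ≤ k → ∀ a T : ℝ, 2 / c - 1 / 4 < a → a ≤ 1 / 2 → 0 < T →
      Real.exp (c * ((k : ℝ) - 1)) / 4 ≤ ‖((a : ℂ) + (T : ℂ) * I) ^ 2‖ →
      ‖((a : ℂ) + (T : ℂ) * I) ^ 2‖ < Real.exp (c * (k : ℝ)) →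
      ‖xiSqArcU k (bandRadius k T) (-(a : ℂ) + (T : ℂ) * I)‖ <
        ‖xiSqArcU k (bandRadius k T) ((a : ℂ) + (T : ℂ) * I)‖ := by
  obtain ⟨k₂, hk₂⟩ := hfar
  have hc0 : 0 < c := by linarith
  have ha₀ : 0 < 2 / c - 1 / 4 := by
    have : 1 / 4 < 2 / c := by rw [div_lt_div_iff₀ (by norm_num) hc0]; linarith
    linarith
  obtain ⟨k₀, hk₀⟩ := topShell_regime_norm 200 c hc0 hc8.le
  refine ⟨max k₀ k₂, fun k hk a T ha ha2 hT hlo hhi => ?_⟩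
  have ha0 : 0 < a := ha₀.trans ha
  obtain ⟨-, hT100, hℓ200, hellLo, hellHi, hh12, hh720, hh4c, hh4c'⟩ :=
    hk₀ k (le_trans (le_max_left _ _) hk) a T ha0 ha2 hT hlo hhi
  -- `T = 2π e^{ℓ_T} ≥ 200`
  have hTexp : T = 2 * π * Real.exp (ell T) := by
    rw [ell, Real.exp_log (by positivity)]; field_simp
  have h2pi : 1 ≤ 2 * π := by linarith [Real.pi_gt_three]
  have hT200 : 200 ≤ T := by
    have h1 : (200 : ℝ) ≤ Real.exp 200 := by
      have := Real.add_one_le_exp (200 : ℝ); linarith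
    have h2 : Real.exp 200 ≤ Real.exp (ell T) := Real.exp_le_exp.2 hℓ200
    have h3 : Real.exp (ell T) ≤ 2 * π * Real.exp (ell T) :=
      le_mul_of_one_le_left (Real.exp_pos _).le h2pi
    linarith
  obtain ⟨M₁, M₂, ε₁, ε₂, h₁, h₂, hlt⟩ :=
    hk₂ k (le_trans (le_max_right _ _) hk) a T ha ha2 hT200 hℓ200 hellLo hellHi hh12 hh720 hh4c hh4c'
  exact norm_lt_norm_of_two_point_models h₁ h₂ hlt

/-! ## The centre inequality of the near frame -/

/-- **Centre inequality from a third.** If `ε ≤ ⅓`, `0 < g`, `56 + 4/g < ℓ` and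
`ℓ/2 − 14 − 1/g ≤ m`, then `ε/((2/ℓ)(1−ε)) < m` (indeed `ε/((2/ℓ)(1−ε)) ≤ ℓ/4 < ℓ/2 − 14 − 1/g`).
On the BAND line: `m = Re(M̃′/M̃)(v₀)` from `re_logDeriv_arcShiftModel_centre_ge_ell` with `δ = g`
the window margin, `ℓ = ℓ_T ≥ 3.5k − 8`, `g ≥ 0.9(2/c − ¼)`. [folklore] -/
theorem centre_ineq_of_le_third {ε ℓ g m : ℝ} (hε : ε ≤ 1 / 3) (hg : 0 < g)
    (hℓ : 56 + 4 / g < ℓ) (hm : ℓ / 2 - 14 - 1 / g ≤ m) : ε / (2 / ℓ * (1 - ε)) < m := by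
  have hg' : 0 < 4 / g := by positivity
  have hℓ0 : 0 < ℓ := by linarith
  have h1ε : 0 < 1 - ε := by linarith
  have e : ε / (2 / ℓ * (1 - ε)) = ε / (1 - ε) * (ℓ / 2) := by
    field_simp
  have h1 : ε / (1 - ε) ≤ 1 / 2 := by
    rw [div_le_iff₀ h1ε]; linarith
  have h2 : ε / (1 - ε) * (ℓ / 2) ≤ 1 / 2 * (ℓ / 2) :=
    mul_le_mul_of_nonneg_right h1 (by positivity)
  have h3 : 14 + 1 / g < ℓ / 4 := by
    have : 1 / g = (4 / g) / 4 := by ring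
    rw [this]; linarith
  rw [e]; linarith

end Summit.RiemannHypothesis.RiemannHypothesis.Theorems.JensenPolynomials.LogBandArc

end
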